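import Summits.Ventures.YMGap.RobustBall.TorusRowsSU2
import Summits.Ventures.YMGap.Thresholds.StarSU3CertifiedRows
import HarnessLib

/-!
# Venture YMGap, track ROBUST-BALL (Y2) — `SU(3)`, `d = 4` torus clustering rows, CONDITIONAL on engine-2's certified
one-link pair (column `Q3torus` of rb-theory's certificate table)

HONEST FRAMING. WHAT THIS IS: a venture file (cell `pub-ymgap`, track Y2 ROBUST-BALL, seat ds-2): `SU(3)`, `d = 4` rows of
the robust torus door (`TorusDoor` / `TorusClustering`, generic in `N`), CONDITIONAL on the two one-link HYPOTHESIS SCHEMAS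
the cell's `SU(3)` ladder uses by name — `H1 = OneLinkPoincareSUN 3 (3/5) (4/5)` and `H2 = OneLinkVarianceBound 3 (11/30)
(49/20)` (certified off-kernel by engine-2, NOT proved in the tree; displayed as hypotheses of every row, exactly like
`StarSU3CertifiedRows`). From `H1`, `H2`: the modulus `OneLinkKRModulus 3 (11/30) (7/5)` (the tree's
`StarSU3Certified.su3_oneLinkKRModulus_sevenFifths`, `√(cv) = 7/5`); tree coupling `β = β_W/3`, radius `(β/3)·6 = 2β_W/3 ≤ 11/30`
(`β_W ≤ 11/20`), Wilson constant `c_W = (7/5)(β/3)·18 = (14/5)β_W`; rows `rhoFR 3 ((14/5)β_W) (2ε) ε < 1` certified in the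
kernel (`√3 ≤ 1.73206`, Taylor majorant of `exp`): `(β_W, ε) = (1/8, 23/100)`, `(1/5, 59/500)`, `(1/4, 69/1000)` — rb-theory's
column `Q3torus`, digit for digit. WHAT THIS IS NOT: not hypothesis-free (H1, H2 are open kernel targets of the cell); no
`ℤ^4` statement; strong-coupling lattice rows only — no continuum, no Millennium claim.

## References
* rb-theory, `HOME/rb/certs/rb_rows.md` column `Q3torus`; engine-2, `ROBUST-ONELINK-TABLE` (the pair H1, H2).
* The tree: `Thresholds/StarSU3CertifiedRows.lean` (`su3_oneLinkKRModulus_sevenFifths`), `StrongCouplingPoincareDoorSUN.lean`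
  (`OneLinkPoincareSUN`), `StrongCouplingVarianceDoorSUN.lean` (`OneLinkVarianceBound`).
-/

noncomputable section

open MeasureTheory ProbabilityTheory Finset Function Real
open Literature.Probability.LatticeModels Literature.Probability.LatticeModels.DobrushinMetric
open Literature.MathematicalPhysics.QuantumLattice hiding torusNorm
open Literature.MathematicalPhysics.QuantumFieldTheory hiding ZdEdge
open Literature.MathematicalPhysics.QuantumFieldTheory.Balaban1983to89.StrongCouplingDobrushinWindow (OneLinkKRModulus)
open Summit.QuantumFields.BalabanUV.InfraRed.StrongCouplingPoincareDoorSUN (OneLinkPoincareSUN)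
open Summit.QuantumFields.BalabanUV.InfraRed.StrongCouplingVarianceDoorSUN (OneLinkVarianceBound)

namespace Summit.Ventures.YMGap.RobustBall

/-! ### Numerical bounds and the certified rows -/

/-- `√3 ≤ 1.73206`. [folklore] -/
theorem sqrt_three_le : Real.sqrt 3 ≤ 1.73206 := by
  rw [show (1.73206 : ℝ) = Real.sqrt (1.73206 ^ 2) by rw [Real.sqrt_sq (by norm_num)]]
  exact Real.sqrt_le_sqrt (by norm_num)

/-- `e^{59/250} ≤ 1.266176`. [folklore] -/
theorem exp_0236_le : Real.exp (59 / 250) ≤ 1.266176 := by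
  have h := Real.exp_bound' (x := 59 / 250) (by norm_num) (by norm_num) (n := 5) (by norm_num)
  refine h.trans ?_
  simp only [Finset.sum_range_succ, Finset.sum_range_zero, Nat.factorial]
  norm_num

/-- `e^{69/500} ≤ 1.147976`. [folklore] -/
theorem exp_0138_le : Real.exp (69 / 500) ≤ 1.147976 := by
  have h := Real.exp_bound' (x := 69 / 500) (by norm_num) (by norm_num) (n := 5) (by norm_num)
  refine h.trans ?_
  simp only [Finset.sum_range_succ, Finset.sum_range_zero, Nat.factorial]
  norm_num

/-- `SU(3)` row `(β_W, ε) = (1/8, 23/100)`: `rhoFR 3 (7/20) (23/50) (23/100) < 1` (`≈ 0.9962`). [folklore] -/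
theorem rhoFR_su3_oneEighth_lt_one : rhoFR 3 (7 / 20) (23 / 50) (23 / 100) < 1 := by
  refine lt_of_le_of_lt (rhoFR_le_of_bounds (by norm_num) (by norm_num) exp_046_le sqrt_three_le) ?_
  norm_num

/-- `SU(3)` row `(β_W, ε) = (1/5, 59/500)`: `rhoFR 3 (14/25) (59/250) (59/500) < 1` (`≈ 0.9989`). [folklore] -/
theorem rhoFR_su3_oneFifth_lt_one : rhoFR 3 (14 / 25) (59 / 250) (59 / 500) < 1 := by
  refine lt_of_le_of_lt (rhoFR_le_of_bounds (by norm_num) (by norm_num) exp_0236_le sqrt_three_le) ?_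
  norm_num

/-- `SU(3)` row `(β_W, ε) = (1/4, 69/1000)`: `rhoFR 3 (7/10) (69/500) (69/1000) < 1` (`≈ 0.9957`). [folklore] -/
theorem rhoFR_su3_oneQuarter_lt_one : rhoFR 3 (7 / 10) (69 / 500) (69 / 1000) < 1 := by
  refine lt_of_le_of_lt (rhoFR_le_of_bounds (by norm_num) (by norm_num) exp_0138_le sqrt_three_le) ?_
  norm_num

/-! ### The conditional `SU(3)` torus currency and rows -/

/-- **`SU(3)`, `d = 4` torus clustering through the Poincaré × variance modulus `7/5`** (CONDITIONAL on H1, H2): for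
`0 < β_W ≤ 11/20` and a certified row `rhoFR 3 ((14/5)β_W) ε₀ ε₁ < 1`, every member of `ClusterDomainFR ε₀ ε₁ r` clusters
on every torus `L ≥ 3` at tree coupling `β_W/3` with constant `24` and rate `−log ρ/(r ⊔ 1)`. [folklore] -/
theorem su3_torusClusteringOnBall_of_pair (hP : OneLinkPoincareSUN 3 (3 / 5) (4 / 5))
    (hV : OneLinkVarianceBound 3 (11 / 30) (49 / 20)) {βW ε₀ ε₁ : ℝ} (hβ0 : 0 < βW) (hβ : βW ≤ 11 / 20)
    (hε₀ : 0 ≤ ε₀) (hε₁ : 0 ≤ ε₁) (r : ℕ) (hρ1 : rhoFR 3 (14 / 5 * βW) ε₀ ε₁ < 1) :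
    TorusClusteringOnBall 3 4 (βW / 3) ε₀ ε₁ r 24 (-Real.log (rhoFR 3 (14 / 5 * βW) ε₀ ε₁) / max r 1) := by
  have hmod : OneLinkKRModulus 3 (11 / 30) (7 / 5) :=
    StarSU3Certified.su3_oneLinkKRModulus_sevenFifths (StarSU3Certified.poincare_elevenThirtieths_of_threeFifths hP) hV
  have hR : |βW / 3| / ((3 : ℕ) : ℝ) * (2 * (((4 : ℕ) : ℝ) - 1)) ≤ 11 / 30 := by
    rw [abs_of_pos (by positivity)]
    push_cast
    linarith
  have hcW : (7 / 5 : ℝ) * (|βW / 3| / ((3 : ℕ) : ℝ)) * (6 * (((4 : ℕ) : ℝ) - 1)) = 14 / 5 * βW := by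
    rw [abs_of_pos (by positivity)]
    push_cast
    ring
  have hρ0 : 0 < rhoFR 3 (14 / 5 * βW) ε₀ ε₁ := rhoFR_pos (by positivity) hε₁
  have h := torusClusteringOnBall_of_oneLinkKRModulus (d := 4) (N := 3) (by norm_num) (by norm_num) (β := βW / 3)
    (by norm_num) hR hmod hε₀ hε₁ r (by rw [hcW]; exact hρ0) (by rw [hcW]; exact hρ1)
  have h24 : (8 : ℝ) * ((3 : ℕ) : ℝ) = 24 := by norm_num
  rw [hcW, h24] at h
  exact h

/-- **`SU(3)` ROW `(β_W, ε) = (1/8, 23/100)`** (tree coupling `1/24`), CONDITIONAL on H1, H2: every member of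
`ClusterDomainFR (23/50) (23/100) r` on every torus `(ℤ/L)⁴`, `L ≥ 3`, clusters with constant `24` and rate
`−log(rhoFR 3 (7/20) (23/50) (23/100))/(r ⊔ 1) > 0`. [folklore] -/
theorem su3_torusClusteringOnBall_oneEighth_of_pair (hP : OneLinkPoincareSUN 3 (3 / 5) (4 / 5))
    (hV : OneLinkVarianceBound 3 (11 / 30) (49 / 20)) (r : ℕ) :
    TorusClusteringOnBall 3 4 (1 / 24) (23 / 50) (23 / 100) r 24
      (-Real.log (rhoFR 3 (7 / 20) (23 / 50) (23 / 100)) / max r 1) := by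
  have e1 : (1 : ℝ) / 8 / 3 = 1 / 24 := by norm_num
  have e2 : (14 : ℝ) / 5 * (1 / 8) = 7 / 20 := by norm_num
  have h := su3_torusClusteringOnBall_of_pair hP hV (βW := 1 / 8) (ε₀ := 23 / 50) (ε₁ := 23 / 100) (by norm_num)
    (by norm_num) (by norm_num) (by norm_num) r (by rw [e2]; exact rhoFR_su3_oneEighth_lt_one)
  rw [e1, e2] at h
  exact h

/-- **`SU(3)` ROW `(β_W, ε) = (1/5, 59/500)`** (tree coupling `1/15`), CONDITIONAL on H1, H2. [folklore] -/
theorem su3_torusClusteringOnBall_oneFifth_of_pair (hP : OneLinkPoincareSUN 3 (3 / 5) (4 / 5))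
    (hV : OneLinkVarianceBound 3 (11 / 30) (49 / 20)) (r : ℕ) :
    TorusClusteringOnBall 3 4 (1 / 15) (59 / 250) (59 / 500) r 24
      (-Real.log (rhoFR 3 (14 / 25) (59 / 250) (59 / 500)) / max r 1) := by
  have e1 : (1 : ℝ) / 5 / 3 = 1 / 15 := by norm_num
  have e2 : (14 : ℝ) / 5 * (1 / 5) = 14 / 25 := by norm_num
  have h := su3_torusClusteringOnBall_of_pair hP hV (βW := 1 / 5) (ε₀ := 59 / 250) (ε₁ := 59 / 500) (by norm_num)
    (by norm_num) (by norm_num) (by norm_num) r (by rw [e2]; exact rhoFR_su3_oneFifth_lt_one)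
  rw [e1, e2] at h
  exact h

/-- **`SU(3)` ROW `(β_W, ε) = (1/4, 69/1000)`** (tree coupling `1/12`), CONDITIONAL on H1, H2. [folklore] -/
theorem su3_torusClusteringOnBall_oneQuarter_of_pair (hP : OneLinkPoincareSUN 3 (3 / 5) (4 / 5))
    (hV : OneLinkVarianceBound 3 (11 / 30) (49 / 20)) (r : ℕ) :
    TorusClusteringOnBall 3 4 (1 / 12) (69 / 500) (69 / 1000) r 24
      (-Real.log (rhoFR 3 (7 / 10) (69 / 500) (69 / 1000)) / max r 1) := by
  have e1 : (1 : ℝ) / 4 / 3 = 1 / 12 := by norm_num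
  have e2 : (14 : ℝ) / 5 * (1 / 4) = 7 / 10 := by norm_num
  have h := su3_torusClusteringOnBall_of_pair hP hV (βW := 1 / 4) (ε₀ := 69 / 500) (ε₁ := 69 / 1000) (by norm_num)
    (by norm_num) (by norm_num) (by norm_num) r (by rw [e2]; exact rhoFR_su3_oneQuarter_lt_one)
  rw [e1, e2] at h
  exact h

/-- rb-theory's requested shape (HEADLINE row 2c): `H1 → H2 → ∃ A m, 0 < m ∧ TorusClusteringOnBall 3 4 (1/24) (23/50)
(23/100) 2 A m`. [folklore] -/
theorem su3_exists_torusClusteringOnBall_oneEighth_of_pair (hP : OneLinkPoincareSUN 3 (3 / 5) (4 / 5))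
    (hV : OneLinkVarianceBound 3 (11 / 30) (49 / 20)) :
    ∃ A m : ℝ, 0 < m ∧ TorusClusteringOnBall 3 4 (1 / 24) (23 / 50) (23 / 100) 2 A m := by
  refine ⟨24, _, ?_, su3_torusClusteringOnBall_oneEighth_of_pair hP hV 2⟩
  have hρ0 : 0 < rhoFR 3 (7 / 20) (23 / 50) (23 / 100) := rhoFR_pos (by norm_num) (by norm_num)
  exact div_pos (neg_pos.2 (Real.log_neg hρ0 rhoFR_su3_oneEighth_lt_one)) (Nat.cast_pos.2 (by norm_num))

end Summit.Ventures.YMGap.RobustBall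

end
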